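import Literature.MathematicalPhysics.QuantumFieldTheory.Balaban1983to89.B9Thm311SmallFieldCoercivityTower
import Literature.MathematicalPhysics.QuantumFieldTheory.Balaban1983to89.B9Eq3126H1Bound
import Literature.MathematicalPhysics.QuantumFieldTheory.Balaban1983to89.B11Eq117TransformationNorm
import Literature.MathematicalPhysics.QuantumFieldTheory.Balaban1983to89.B9Eq319QprimeTowerCentre

/-!
# `Balaban1983to89.B9Eq3126H1BoundTower` — T. Bałaban, *Propagators for lattice gauge theories in a background field*, Commun. Math. Phys. **99**
# (1985) 389–434 [Balaban1985BackgroundPropagators] (3.126) p. 420, (3.153) p. 426 with Thm 3.4 p. 400 ∕ Thm 3.11 p. 416 AT `k = n+1` AVERAGING LEVELS: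
# PRINT's `k`-LEVEL OPERATOR `Δ_a(U)` (composite averagings (3.15)∕(3.19)) IS COERCIVE AND BOUNDED at every small field of a fixed lattice, and its
# `H_{1,k}(U) = G₁Q_k†(Q_kG₁Q_k†)⁻¹`, `𝔊_k(U) = G₁𝔓*` ARE BOUNDED UNIFORMLY — `B9Thm311SmallFieldGreen` + `B9Eq3126H1Bound` ONE STOREY UP, modulo the
# displayed tower averaging letters (as `B9Thm311SmallFieldCoercivityTower`)

statement-level skeleton of published theorems with citation tags; proofs where landed; nothing here is a claim about the Yang–Mills mass gap

CITATION HEADER (lean-in-tree rule).  Audit cell `pub-balaban`, sub-cell `t4`, BINDER row NE9; filed by the row OWNER lineage `b2b-balaban-t4-ne9-p1`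
(gen 83).  Sources READ by this lineage in the held texts: [Balaban1985BackgroundPropagators] pp. 392–397, 400, 404, 416, 420, 426
(`paper:balaban1985-cmp99-background-propagators`, journal page = PDF page + 388).

THE PRINT (verbatim).  p. 420, (3.126): *«HB = GQ*(QGQ*)⁻¹B»*; p. 407, (3.86): *«G(U′U) = G(U)(I − V(A)G(U))⁻¹ … convergence is in the operator
norm for α₁ sufficiently small»*; p. 416, Thm 3.11: *«the operators Δ′_a, G′, (Q′G′²Q′*)⁻¹, Δ_a, G are positive definite»*; (3.15) p. 393 the
composite averagings.

WHY THIS FILE (cell context).  `Support/NE9CurChartTower` (this generation) builds the chart of `cur U` for the `k`-level operator at every small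
field with radii depending on `U`; the `k`-level UNIFORM BALL (radii before `∀ U`, one storey above `Support/NE9CurChartUniformBall`) needs UNIFORM
bounds of `G_{1,k}(U)`, `H_{1,k}(U)`, `𝔊_k(U)` — this file, on the `L²` carriers (§1–§3) and in the chart's Banach norms (§4 = `B9Eq3126H1BoundCLM` one
storey up: [Balaban1985Variational] p. 295 L7–L9 *«By Theorem 3.13 of [5] the norm max{| |_(−1), |∇ |_(−2)} of the transformation can be estimated by
[(117)] if ε₄ + B₀|B| ≤ a₃»*); the uniform ball is the next file (`g83/TOWER-SPECIES-PLAN.md` §2 (b)).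

WHAT IS PROVED (sorry-free; no `def`, no `Prop` placeholder; no inequality of the paper asserted hypothesis-free).
* §1 **`exists_coercive_laplaceAk_of_small_field`** — `∀ CS ≥ 0, ∃ γ₁ ε₃ > 0` such that at every background of the tower's displayed data with
  unit-bounded `ε`-small bond variables, `hRS`, right inverses `S₁`∕`S₂` of `Q′_k(1)`∕`Q′_k(U)` bounded by `CS` and tower averaging letters `ρ′`,
  `δ_Q` with `ε + ρ′ + δ_Q ≤ ε₃`: `γ₁‖x‖² ≤ re⟨x, Δ_a^{(k)}(U)x⟩` (principal coercivity `B9Thm311SmallFieldCoercivityTower` minus the fine-lattice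
  curvature form bound `B9Ineq369CurvatureSmall.norm_inner_curvOp_self_le`); **`norm_G1k_le_of_small_field`** (`‖G₁(U)y‖ ≤ γ₁⁻¹‖y‖`).
* §2 **`norm_laplaceAk_le`** — `‖Δ_a^{(k)}(U)x‖ ≤ (64d|η|⁻² + 16d|η|⁻² + 128d·C_τM_φ²(|η|^d∕c₀)|η|⁻²ε + |a|M_{QU}²)‖x‖` for `‖Q_k(U)x‖ ≤ M_{QU}‖x‖`
  (the fine-lattice pieces of `B9Eq3126H1Bound.norm_laplaceAofBackground_le` verbatim; `R(U)` of the tower is still a projection).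
* §3 **`exists_H1k_frakGk_bound_of_small_field`** — `∀ CS ≥ 0, ∃ C_H C_G ε₅ > 0` such that at every such background with `ε + ρ′ + δ_Q ≤ ε₅` and ANY
  witnesses `hpos`, `hQ`: `‖H1LatticeK hpos hQ b‖ ≤ C_H‖b‖`, `‖frakGLatticeK hpos hQ x‖ ≤ C_G‖x‖` at the `k`-level letters (`B9Eq3126GreenLetters` at
  `Q := Q_k(U)`: operator bound `M_{Q1} + δ_Q`, adjoint modulus `μ_{Q1} − δ_Q ≥ μ_{Q1}∕2` from the flat `Q_k(1)` onto, `B9Eq315QTowerFlat.QkW_one_surjective`).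
* §4 **`exists_H1k_frakGk_CLM_bound_of_small_field`** — the (N)-reading: `∀ CS ≥ 0`, for FIXED level maps `lev₀ lev_B lev₁`, `∃ C_H′ C_G′ ε₅ > 0` with
  `‖H1LatticeCLM φ hpos hQ lev₁ (∇_U)‖ ≤ C_H′`, `‖frakGLatticeCLM φ hpos hQ lev₁ (∇_U)‖ ≤ C_G′` (the chart's letters `NegSize → Space115 … (∇_U)` of
  `Support/NE9CurChartTower`) at every such background — §3 transported by `B11Eq117TransformationNorm` (`norm_H1CLM_le`, `norm_frakG_fun_le`,
  `‖∇_U‖ ≤ 2|η|⁻¹` `norm_nabla115_le`), exactly as `B9Eq3126H1BoundCLM` does one storey below.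
* §5 (APPEND v1.2, NE9 leaf-02 gen 63 on the OWNER's W-16 «leaf-02 appends»; v1.2 also carries DOCFIX D-1 — `norm_G1k_le_of_coercive`'s docstring
  page «Thm 3.4 p.397 ↦ p.400», doc-only, leaf-02 A-1 l.45582, the owner's word W-19 l.45689) **`exists_coercive_laplaceAk_of_small_field'`**,
  **`exists_H1k_frakGk_bound_of_small_field'`**, **`exists_H1k_frakGk_CLM_bound_of_small_field'`** — §1∕§3∕§4 WITH THE SECTIONS DISCHARGED: the
  binders `(S₁ S₂ …) hS₁ hS₂ hS₁n hS₂n` and the parameter `CS`∕`hCS` are GONE, inhabited by NE9 leaf-02's universal right inverse of the composite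
  `Q′_k` (`B9Eq319QprimeTowerCentre.exists_QprimeTowerW_rightInverse`; `S₁ = S₂ = S`, `CS := (L^d)^{n+1}·√(c₀·#T_m)`); displays left: `ρ′`, `δ_Q`, `hRS`.
HONEST SCOPE.  [folklore] finite-dimensional bookkeeping one storey up; `γ₁`, `C_H`, `C_G`, `ε₅` finite-lattice numbers depending also on `k` and `CS`;
the tower averaging letters and the right inverses DISPLAYED (suppliers: `B9Eq315QTowerLipschitz`, `B7Eq43AveragedSmallness`, `B9Eq319QprimeTowerCentre`);
NOT print's lattice-uniform `B₀`, NOT decay, NOT uniformity in the lattice; NOT summit progress (cell pub-balaban: NE9 NOT PRINTED ∕ NOT PROVED; spine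
PROVED 0∕9).  NEW file; nothing modified.  Net new unproved facts: 0.
-/

noncomputable section

open scoped InnerProductSpace ComplexConjugate BigOperators

namespace Literature.MathematicalPhysics.QuantumFieldTheory.Balaban1983to89.B9Eq3126H1BoundTower

open B4Sect5Torus (TSite)
open B9SectCLatticeCarrier (Bond)
open B7Prop1Explicit (U1 Wcx boxVec)
open B9Eq311L2Pairing (WL2)
open B9Eq319QprimeTorus (fineP)
open B11Eq103H1Complex (SiteL2K BondL2K covDerivL2K covDivL2K laplaceALatticeK H1LatticeK frakGLatticeK G1LatticeK KinvLatticeK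
  adjoint_injective_of_surjective H1LatticeCLM frakGLatticeCLM)
open B11Eq115Space (NegSize Space115 levWeight)
open B11Eq111FrakG (nabla115)
open B11Eq117TransformationNorm (norm_H1CLM_le norm_frakG_fun_le norm_nabla115_le)
open B9Eq310HessianOperator (adTransportW principalOpK hessOp hessOp_apply curvOp)
open B9Eq310DeltaPrime (plaqHolU)
open B9Eq315QTorus (perCfg cornerSite)
open B9Eq315QTower (towerP UlevOf)
open B9Eq315QTowerFlat (perCfg_UlevOf_one_mem_U1 norm_Wcx_UlevOf_one_sub_one_le QkW_one_surjective)
open B9Eq326OperatorTower (QprimeTowerW QkW RofUk laplaceAk)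
open B9Eq368ProjectionRemainder (norm_projR_le)
open B9Eq373DerivativeRemainderL2 (norm_adjoint_apply_le norm_covDerivL2K_le norm_covDivL2K_le norm_covCurlL2K_le norm_covCoCurlL2K_le)
open B9Eq384RemainderLetters (norm_adTransportW_sub_le)
open B9Thm311SmallFieldClosed (norm_plaqHolU_sub_one_le)
open B9Ineq369CurvatureOperatorBound (norm_curvOp_le)
open B9Ineq369CurvatureSmall (norm_inner_curvOp_self_le)
open B9Eq3126GreenLetters (norm_greenK_le norm_H1K_le norm_frakGLin_le exists_modulus_of_injective adjoint_injective_of_modulus)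
open B9Thm311SmallFieldCoercivityTower (exists_coercive_principalk_of_small_field)

variable {d : ℕ} (L : ℕ) [NeZero L] (m : Fin d → ℕ) [∀ i, NeZero (m i)] (n : ℕ) (hL : 1 ≤ L)
  {𝔸 : Type*} [NormedRing 𝔸] [NormedAlgebra ℂ 𝔸] [CompleteSpace 𝔸] [NormOneClass 𝔸] [StarRing 𝔸] [NormedStarGroup 𝔸] [StarModule ℂ 𝔸]
  {W : Type*} [NormedAddCommGroup W] [InnerProductSpace ℂ W] [FiniteDimensional ℂ W] (φ : W ≃ₗ[ℂ] 𝔸) {c₀ c₁ : ℝ} [Fact (0 < c₀)] [Fact (0 < c₁)]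
  (α : ℕ → ℝ) (hα1 : ∀ j, α j ≤ 1 / 64)

/-! ## §1 `Δ_a^{(k)}(U)` coercive at every small field (with the curvature part); `G₁(U)` bounded -/

/-- **PRINT's `k`-LEVEL `Δ_a(U)` IS UNIFORMLY COERCIVE AT EVERY SMALL FIELD OF A FIXED LATTICE** (modulo the displayed tower averaging letters and
right inverses): `∀ CS ≥ 0, ∃ γ₁ ε₃ > 0` with `γ₁‖x‖² ≤ re⟨x, Δ_a^{(k)}(U)x⟩` whenever `ε + ρ′ + δ_Q ≤ ε₃` — the principal coercivity `γ` of
`B9Thm311SmallFieldCoercivityTower.exists_coercive_principalk_of_small_field` minus the curvature form bound `128d·C_τM_φ²(|η|^d∕c₀)|η|⁻²ε ≤ γ∕2`; `γ₁ = γ∕2`.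
[cite: Balaban1985BackgroundPropagators, Thm 3.11 p.416, (3.69) p.404, (3.26) p.395] -/
theorem exists_coercive_laplaceAk_of_small_field {η : ℝ} (hη : η ≠ 0) {a : ℝ} (ha : 0 < a) {Mφ Mφ' : ℝ} (hMφ : 0 ≤ Mφ) (hMφ' : 0 ≤ Mφ')
    (hφ : ∀ w, ‖φ w‖ ≤ Mφ * ‖w‖) (hφ' : ∀ X, ‖φ.symm X‖ ≤ Mφ' * ‖X‖) (τ : 𝔸 →ₗ[ℂ] ℂ) {Cτ : ℝ} (hτ : ∀ X, ‖τ X‖ ≤ Cτ * ‖X‖) (hCτ : 0 ≤ Cτ)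
    {CS : ℝ} (hCS : 0 ≤ CS) :
    ∃ γ₁ ε₃ : ℝ, 0 < γ₁ ∧ 0 < ε₃ ∧ ∀ (U : Bond d (towerP L m (n + 1)) → 𝔸ˣ)
      (hU1 : ∀ (j : ℕ) (x : B7Prop1Explicit.Site d) (κ : Fin d), perCfg (towerP L m (j + 1)) (UlevOf L m (n + 1) U j) x κ ∈ U1 𝔸)
      (hreg : ∀ (j : ℕ) (y : TSite d (towerP L m j)) (κ : Fin d) (r : Fin d → Fin L),
        ‖((Wcx L (perCfg (towerP L m (j + 1)) (UlevOf L m (n + 1) U j)) (cornerSite L y) κ (boxVec L r) : 𝔸ˣ) : 𝔸) - 1‖ ≤ α j)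
      (S₁ S₂ : (TSite d m → W) →ₗ[ℂ] SiteL2K ℂ d (towerP L m (n + 1)) c₀ W)
      {ε ρ' δQ : ℝ}, 0 ≤ ε → 0 ≤ ρ' → 0 ≤ δQ → ε + ρ' + δQ ≤ ε₃ →
      (∀ b, U b ∈ U1 𝔸) → (∀ b, ‖(U b : 𝔸) - 1‖ ≤ ε) →
      (∀ (b : Bond d (towerP L m (n + 1))) (v u : W), ⟪adTransportW φ U b v, u⟫_ℂ = ⟪v, adTransportW φ (fun b => (U b)⁻¹) b u⟫_ℂ) →
      (∀ f, QprimeTowerW L m n φ (fun _ : Bond d (towerP L m (n + 1)) => (1 : 𝔸ˣ)) (S₁ f) = f) →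
      (∀ f, QprimeTowerW L m n φ U (S₂ f) = f) → (∀ f, ‖S₁ f‖ ≤ CS * ‖f‖) → (∀ f, ‖S₂ f‖ ≤ CS * ‖f‖) →
      (∀ l : SiteL2K ℂ d (towerP L m (n + 1)) c₀ W,
        ‖QprimeTowerW L m n φ U l - QprimeTowerW L m n φ (fun _ : Bond d (towerP L m (n + 1)) => (1 : 𝔸ˣ)) l‖ ≤ ρ' * ‖l‖) →
      (∀ x : BondL2K ℂ d (towerP L m (n + 1)) c₀ W, ‖QkW L m n φ U hL α hα1 hU1 hreg (c₁ := c₁) x -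
        QkW L m n φ (fun _ : Bond d (towerP L m (n + 1)) => (1 : 𝔸ˣ)) hL (fun _ => 0) (fun _ => by norm_num)
          (perCfg_UlevOf_one_mem_U1 L m (n + 1)) (norm_Wcx_UlevOf_one_sub_one_le L m (n + 1) (fun _ => 0) (fun _ => le_rfl)) (c₁ := c₁) x‖ ≤
        δQ * ‖x‖) →
      ∀ x : BondL2K ℂ d (towerP L m (n + 1)) c₀ W, γ₁ * ‖x‖ ^ 2 ≤
        RCLike.re ⟪x, laplaceAk L m n φ η U hL α hα1 hU1 hreg τ (c₀ := c₀) (c₁ := c₁) a x⟫_ℂ := by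
  have hc₀ : 0 < c₀ := Fact.out
  obtain ⟨γ, ε₀, hγ, hε₀, H⟩ := exists_coercive_principalk_of_small_field L m n hL φ (c₀ := c₀) (c₁ := c₁) α hα1 hη ha hMφ hMφ' hφ hφ' hCS
  obtain ⟨Kc, hKcdef⟩ : ∃ Kc : ℝ, Kc = 32 * d * Cτ * Mφ ^ 2 * (|η| ^ d / c₀) * (‖((η : ℂ))⁻¹‖ ^ 2 * 4) := ⟨_, rfl⟩
  have hKc : 0 ≤ Kc := by rw [hKcdef]; positivity
  refine ⟨γ / 2, min ε₀ (γ / (Kc + 1) / 2), by positivity, by positivity, ?_⟩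
  intro U hU1 hreg S₁ S₂ ε ρ' δQ hε hρ' hδQ ht hUb hUε hRS hS₁ hS₂ hS₁n hS₂n hQ' hQ x
  have hUb' : ∀ b : Bond d (towerP L m (n + 1)), ‖(U b : 𝔸)‖ ≤ 1 ∧ ‖(((U b)⁻¹ : 𝔸ˣ) : 𝔸)‖ ≤ 1 := fun b => B7Prop1Explicit.mem_U1.1 (hUb b)
  have hpl : ∀ p : B9SectCLatticeCarrier.Plaq d (towerP L m (n + 1)), ‖(plaqHolU U p : 𝔸) - 1‖ ≤ 4 * ε := norm_plaqHolU_sub_one_le hUb hUε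
  have hγU := H U hU1 hreg S₁ S₂ hε hρ' hδQ (ht.trans (min_le_left _ _)) hUb hUε hRS hS₁ hS₂ hS₁n hS₂n hQ' hQ x
  have hK := norm_inner_curvOp_self_le φ hτ hCτ hφ η hUb' hpl (by positivity) x
  have hεt : ε ≤ γ / (Kc + 1) / 2 := by
    have : ε ≤ ε + ρ' + δQ := by linarith
    exact this.trans (ht.trans (min_le_right _ _))
  have hKε : 32 * d * Cτ * Mφ ^ 2 * (|η| ^ d / c₀) * (‖((η : ℂ))⁻¹‖ ^ 2 * (4 * ε)) ≤ γ / 2 := by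
    have h1 : 32 * d * Cτ * Mφ ^ 2 * (|η| ^ d / c₀) * (‖((η : ℂ))⁻¹‖ ^ 2 * (4 * ε)) = Kc * ε := by rw [hKcdef]; ring
    rw [h1]
    have h3 : Kc * ε ≤ Kc * (γ / (Kc + 1) / 2) := mul_le_mul_of_nonneg_left hεt hKc
    have h4 : Kc * (γ / (Kc + 1) / 2) ≤ γ / 2 := by
      rw [mul_div_assoc', mul_div_assoc', div_div, div_le_div_iff₀ (by positivity) (by norm_num)]
      nlinarith
    exact h3.trans h4
  -- split `Δ_a(U) = Δ_prin(U) + Δ′(U)`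
  have hsplit : laplaceAk L m n φ η U hL α hα1 hU1 hreg τ (c₀ := c₀) (c₁ := c₁) a x =
      laplaceALatticeK ((η : ℂ))⁻¹ (adTransportW φ U) (adTransportW φ fun b => (U b)⁻¹) (principalOpK φ η U) (RofUk L m n φ η U)
        (QkW L m n φ U hL α hα1 hU1 hreg (c₁ := c₁)) a x + curvOp φ τ η U x := by
    show laplaceALatticeK ((η : ℂ))⁻¹ (adTransportW φ U) (adTransportW φ fun b => (U b)⁻¹) (hessOp φ η U τ) (RofUk L m n φ η U)
        (QkW L m n φ U hL α hα1 hU1 hreg (c₁ := c₁)) a x = _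
    simp only [laplaceALatticeK, B11Eq103H1Complex.laplaceAK_apply, hessOp_apply]
    abel
  rw [hsplit, inner_add_right, map_add]
  have h2 : -(32 * d * Cτ * Mφ ^ 2 * (|η| ^ d / c₀) * (‖((η : ℂ))⁻¹‖ ^ 2 * (4 * ε)) * ‖x‖ ^ 2) ≤ RCLike.re ⟪x, curvOp φ τ η U x⟫_ℂ := by
    have h := (RCLike.abs_re_le_norm ⟪x, curvOp φ τ η U x⟫_ℂ).trans hK
    rw [abs_le] at h
    exact h.1
  nlinarith [hγU, h2, hKε, sq_nonneg ‖x‖, mul_nonneg hKc hε]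

/-! ## §2 The operator bound of `Δ_a^{(k)}(U)` -/

/-- **PRINT's `k`-LEVEL `Δ_a(U)` IS BOUNDED AT EVERY SMALL FIELD**: `‖Δ_a^{(k)}(U)x‖ ≤ M·‖x‖` with
`M = 64d|η|⁻² + 16d|η|⁻² + 128d·C_τM_φ²(|η|^d∕c₀)|η|⁻²·ε + |a|·M_{QU}²` (`M_{QU}` any operator bound of `Q_k(U)`) — the fine-lattice curl∕cocurl, `D`∕`D*`,
curvature bounds of `B9Eq3126H1Bound.norm_laplaceAofBackground_le` verbatim; `R(U)` of the tower is a projection (`norm_projR_le`).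
[cite: Balaban1985BackgroundPropagators, (3.26) p.395, (3.10) p.392, (3.69) p.404] -/
theorem norm_laplaceAk_le {Mφ Mφ' : ℝ} (hMφ : 0 ≤ Mφ) (hMφ' : 0 ≤ Mφ') (hφ : ∀ w, ‖φ w‖ ≤ Mφ * ‖w‖) (hφ' : ∀ X, ‖φ.symm X‖ ≤ Mφ' * ‖X‖)
    (τ : 𝔸 →ₗ[ℂ] ℂ) {Cτ : ℝ} (hτ : ∀ X, ‖τ X‖ ≤ Cτ * ‖X‖) (hCτ : 0 ≤ Cτ) {η : ℝ} (a : ℝ)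
    (U : Bond d (towerP L m (n + 1)) → 𝔸ˣ)
    (hU1 : ∀ (j : ℕ) (x : B7Prop1Explicit.Site d) (κ : Fin d), perCfg (towerP L m (j + 1)) (UlevOf L m (n + 1) U j) x κ ∈ U1 𝔸)
    (hreg : ∀ (j : ℕ) (y : TSite d (towerP L m j)) (κ : Fin d) (r : Fin d → Fin L),
      ‖((Wcx L (perCfg (towerP L m (j + 1)) (UlevOf L m (n + 1) U j)) (cornerSite L y) κ (boxVec L r) : 𝔸ˣ) : 𝔸) - 1‖ ≤ α j)
    (hUb : ∀ b, U b ∈ U1 𝔸) {ε : ℝ} (hε : 0 ≤ ε) (hεR1 : 2 * Mφ * Mφ' * ε ≤ 1) (hUε : ∀ b, ‖(U b : 𝔸) - 1‖ ≤ ε)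
    (hRS : ∀ (b : Bond d (towerP L m (n + 1))) (v u : W), ⟪adTransportW φ U b v, u⟫_ℂ = ⟪v, adTransportW φ (fun b => (U b)⁻¹) b u⟫_ℂ)
    {MQU : ℝ} (hMQU : 0 ≤ MQU) (hQU : ∀ x : BondL2K ℂ d (towerP L m (n + 1)) c₀ W, ‖QkW L m n φ U hL α hα1 hU1 hreg (c₁ := c₁) x‖ ≤ MQU * ‖x‖)
    (x : BondL2K ℂ d (towerP L m (n + 1)) c₀ W) :
    ‖laplaceAk L m n φ η U hL α hα1 hU1 hreg τ (c₀ := c₀) (c₁ := c₁) a x‖ ≤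
      (64 * d * ‖((η : ℂ))⁻¹‖ ^ 2 + 16 * ‖((η : ℂ))⁻¹‖ ^ 2 * d + 32 * d * Cτ * Mφ ^ 2 * (|η| ^ d / c₀) * (‖((η : ℂ))⁻¹‖ ^ 2 * (4 * ε))
        + MQU * (|a| * MQU)) * ‖x‖ := by
  have hc : conj ((η : ℂ))⁻¹ = ((η : ℂ))⁻¹ := by rw [map_inv₀, Complex.conj_ofReal]
  have hUb' : ∀ b : Bond d (towerP L m (n + 1)), ‖(U b : 𝔸)‖ ≤ 1 ∧ ‖(((U b)⁻¹ : 𝔸ˣ) : 𝔸)‖ ≤ 1 := fun b => B7Prop1Explicit.mem_U1.1 (hUb b)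
  have hpl : ∀ p : B9SectCLatticeCarrier.Plaq d (towerP L m (n + 1)), ‖(plaqHolU U p : 𝔸) - 1‖ ≤ 4 * ε := norm_plaqHolU_sub_one_le hUb hUε
  have hR : ∀ (b : Bond d (towerP L m (n + 1))) (w : W), ‖adTransportW φ U b w - w‖ ≤ 1 * ‖w‖ := fun b w =>
    (norm_adTransportW_sub_le φ hφ hφ' hMφ' U b (hUb b) (hUε b) w).trans (mul_le_mul_of_nonneg_right hεR1 (norm_nonneg _))
  have hd : Real.sqrt d * Real.sqrt d = d := Real.mul_self_sqrt (Nat.cast_nonneg d)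
  -- the four pieces
  have hP : ‖principalOpK φ η U x‖ ≤ 64 * d * ‖((η : ℂ))⁻¹‖ ^ 2 * ‖x‖ := by
    rw [B9Eq310HessianOperator.principalOpK_eq_comp, LinearMap.comp_apply]
    calc _ ≤ 4 * Real.sqrt d * ((1 + 1) * ‖((η : ℂ))⁻¹‖) * ‖B9Eq310HessianOperator.covCurlL2K ℂ c₀ ((η : ℂ))⁻¹ (adTransportW φ U) x‖ :=
          norm_covCoCurlL2K_le _ hc zero_le_one hR hRS _
      _ ≤ 4 * Real.sqrt d * ((1 + 1) * ‖((η : ℂ))⁻¹‖) * (4 * Real.sqrt d * ((1 + 1) * ‖((η : ℂ))⁻¹‖) * ‖x‖) :=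
          mul_le_mul_of_nonneg_left (norm_covCurlL2K_le _ zero_le_one hR x) (by positivity)
      _ = 64 * (Real.sqrt d * Real.sqrt d) * ‖((η : ℂ))⁻¹‖ ^ 2 * ‖x‖ := by ring
      _ = 64 * d * ‖((η : ℂ))⁻¹‖ ^ 2 * ‖x‖ := by rw [hd]
  have hC : ‖curvOp φ τ η U x‖ ≤ 32 * d * Cτ * Mφ ^ 2 * (|η| ^ d / c₀) * (‖((η : ℂ))⁻¹‖ ^ 2 * (4 * ε)) * ‖x‖ :=
    norm_curvOp_le φ hτ hCτ hφ η hUb' hpl hMφ (by positivity) x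
  have hDRD : ‖covDerivL2K ℂ c₀ ((η : ℂ))⁻¹ (adTransportW φ U) (RofUk L m n φ η U (covDivL2K ℂ c₀ ((η : ℂ))⁻¹ (adTransportW φ fun b => (U b)⁻¹) x))‖ ≤
      16 * ‖((η : ℂ))⁻¹‖ ^ 2 * d * ‖x‖ := by
    have h1 := norm_covDerivL2K_le ((η : ℂ))⁻¹ zero_le_one hR (RofUk L m n φ η U (covDivL2K ℂ c₀ ((η : ℂ))⁻¹ (adTransportW φ fun b => (U b)⁻¹) x))
    have h2 : ‖RofUk L m n φ η U (covDivL2K ℂ c₀ ((η : ℂ))⁻¹ (adTransportW φ fun b => (U b)⁻¹) x)‖ ≤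
        ‖covDivL2K ℂ c₀ ((η : ℂ))⁻¹ (adTransportW φ fun b => (U b)⁻¹) x‖ := by
      unfold RofUk B11Eq103H1Complex.RLatticeK; exact norm_projR_le _ _ _
    have h3 := norm_covDivL2K_le ((η : ℂ))⁻¹ hc zero_le_one hR hRS x
    calc _ ≤ 2 * (1 + 1) * ‖((η : ℂ))⁻¹‖ * Real.sqrt d * ‖RofUk L m n φ η U (covDivL2K ℂ c₀ ((η : ℂ))⁻¹ (adTransportW φ fun b => (U b)⁻¹) x)‖ := h1
      _ ≤ 2 * (1 + 1) * ‖((η : ℂ))⁻¹‖ * Real.sqrt d * (2 * (1 + 1) * ‖((η : ℂ))⁻¹‖ * Real.sqrt d * ‖x‖) :=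
          mul_le_mul_of_nonneg_left (h2.trans h3) (by positivity)
      _ = 16 * ‖((η : ℂ))⁻¹‖ ^ 2 * (Real.sqrt d * Real.sqrt d) * ‖x‖ := by ring
      _ = 16 * ‖((η : ℂ))⁻¹‖ ^ 2 * d * ‖x‖ := by rw [hd]
  have hQQ : ‖LinearMap.adjoint (QkW L m n φ U hL α hα1 hU1 hreg (c₀ := c₀) (c₁ := c₁)) ((RCLike.ofReal a : ℂ) • QkW L m n φ U hL α hα1 hU1 hreg (c₀ := c₀) (c₁ := c₁) x)‖ ≤
      MQU * (|a| * MQU) * ‖x‖ := by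
    refine (norm_adjoint_apply_le _ hMQU hQU _).trans ?_
    rw [norm_smul, RCLike.norm_ofReal]
    calc MQU * (|a| * ‖QkW L m n φ U hL α hα1 hU1 hreg (c₀ := c₀) (c₁ := c₁) x‖) ≤ MQU * (|a| * (MQU * ‖x‖)) := by gcongr; exact hQU x
      _ = MQU * (|a| * MQU) * ‖x‖ := by ring
  -- assembly
  have hsplit : laplaceAk L m n φ η U hL α hα1 hU1 hreg τ (c₀ := c₀) (c₁ := c₁) a x =
      principalOpK φ η U x + curvOp φ τ η U x +
        covDerivL2K ℂ c₀ ((η : ℂ))⁻¹ (adTransportW φ U) (RofUk L m n φ η U (covDivL2K ℂ c₀ ((η : ℂ))⁻¹ (adTransportW φ fun b => (U b)⁻¹) x)) +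
        LinearMap.adjoint (QkW L m n φ U hL α hα1 hU1 hreg (c₀ := c₀) (c₁ := c₁)) ((RCLike.ofReal a : ℂ) • QkW L m n φ U hL α hα1 hU1 hreg (c₀ := c₀) (c₁ := c₁) x) := by
    show laplaceALatticeK ((η : ℂ))⁻¹ (adTransportW φ U) (adTransportW φ fun b => (U b)⁻¹) (hessOp φ η U τ) (RofUk L m n φ η U)
        (QkW L m n φ U hL α hα1 hU1 hreg (c₁ := c₁)) a x = _
    simp only [laplaceALatticeK, B11Eq103H1Complex.laplaceAK_apply, hessOp_apply]
  rw [hsplit]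
  calc _ ≤ ‖principalOpK φ η U x + curvOp φ τ η U x‖ +
        ‖covDerivL2K ℂ c₀ ((η : ℂ))⁻¹ (adTransportW φ U) (RofUk L m n φ η U (covDivL2K ℂ c₀ ((η : ℂ))⁻¹ (adTransportW φ fun b => (U b)⁻¹) x))‖ +
        ‖LinearMap.adjoint (QkW L m n φ U hL α hα1 hU1 hreg (c₀ := c₀) (c₁ := c₁)) ((RCLike.ofReal a : ℂ) • QkW L m n φ U hL α hα1 hU1 hreg (c₀ := c₀) (c₁ := c₁) x)‖ :=
        norm_add₃_le
    _ ≤ (64 * d * ‖((η : ℂ))⁻¹‖ ^ 2 * ‖x‖ + 32 * d * Cτ * Mφ ^ 2 * (|η| ^ d / c₀) * (‖((η : ℂ))⁻¹‖ ^ 2 * (4 * ε)) * ‖x‖) +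
        16 * ‖((η : ℂ))⁻¹‖ ^ 2 * d * ‖x‖ + MQU * (|a| * MQU) * ‖x‖ :=
        add_le_add (add_le_add ((norm_add_le _ _).trans (add_le_add hP hC)) hDRD) hQQ
    _ = _ := by ring

/-! ## §3 `H_{1,k}(U)`, `𝔊_k(U)` bounded uniformly over the small fields of a fixed lattice -/

omit [NormedStarGroup 𝔸] in
/-- **`G₁(U) = (Δ_a^{(k)}(U))⁻¹` IS UNIFORMLY BOUNDED**: with `γ₁, ε₃` of §1 and ANY positivity witness `hpos`, `‖G1LatticeK hpos y‖ ≤ γ₁⁻¹‖y‖` (crude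
operator form of Thm 3.4 at a fixed lattice, `k` levels). [cite: Balaban1985BackgroundPropagators, Thm 3.4 p.400, Thm 3.11 p.416, (3.86) p.407] -/
theorem norm_G1k_le_of_coercive {η : ℝ} (τ : 𝔸 →ₗ[ℂ] ℂ) {a γ₁ : ℝ} (hγ₁ : 0 < γ₁) (U : Bond d (towerP L m (n + 1)) → 𝔸ˣ)
    (hU1 : ∀ (j : ℕ) (x : B7Prop1Explicit.Site d) (κ : Fin d), perCfg (towerP L m (j + 1)) (UlevOf L m (n + 1) U j) x κ ∈ U1 𝔸)
    (hreg : ∀ (j : ℕ) (y : TSite d (towerP L m j)) (κ : Fin d) (r : Fin d → Fin L),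
      ‖((Wcx L (perCfg (towerP L m (j + 1)) (UlevOf L m (n + 1) U j)) (cornerSite L y) κ (boxVec L r) : 𝔸ˣ) : 𝔸) - 1‖ ≤ α j)
    (hcoer : ∀ x : BondL2K ℂ d (towerP L m (n + 1)) c₀ W, γ₁ * ‖x‖ ^ 2 ≤
      RCLike.re ⟪x, laplaceAk L m n φ η U hL α hα1 hU1 hreg τ (c₀ := c₀) (c₁ := c₁) a x⟫_ℂ)
    (hpos : ∀ x : BondL2K ℂ d (towerP L m (n + 1)) c₀ W, x ≠ 0 →
      0 < RCLike.re ⟪x, laplaceAk L m n φ η U hL α hα1 hU1 hreg τ (c₀ := c₀) (c₁ := c₁) a x⟫_ℂ)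
    (y : BondL2K ℂ d (towerP L m (n + 1)) c₀ W) : ‖G1LatticeK hpos y‖ ≤ γ₁⁻¹ * ‖y‖ :=
  norm_greenK_le hγ₁ hcoer hpos y

set_option maxRecDepth 8192 in
set_option maxHeartbeats 800000 in
/-- **`H_{1,k}(U)` AND `𝔊_k(U)` ARE BOUNDED UNIFORMLY OVER THE SMALL FIELDS OF A FIXED LATTICE** ([B9] (3.126), (3.153) at `k` levels): for every `CS ≥ 0`
there are `C_H, C_G, ε₅ > 0` (finite-lattice numbers) such that for EVERY background of the tower's displayed data with `U(b) ∈ U1`, `‖U(b) − 1‖ ≤ ε`,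
`hRS`, right inverses `S₁`∕`S₂` bounded by `CS`, tower averaging letters `ρ′`, `δ_Q` with `ε + ρ′ + δ_Q ≤ ε₅`, and ANY witnesses `hpos` ∕ `hQ`:
`‖H1LatticeK hpos hQ b‖ ≤ C_H‖b‖`, `‖frakGLatticeK hpos hQ x‖ ≤ C_G‖x‖` — `B9Eq3126GreenLetters` at `Q := Q_k(U)` (operator bound `M_{Q1} + δ_Q`,
adjoint modulus `≥ μ_{Q1}∕2` from the flat `Q_k(1)` onto, `QkW_one_surjective`), §1's `γ₁`, §2's bound. [cite: Balaban1985BackgroundPropagators, (3.126) p.420, (3.153) p.426, Thm 3.4 p.400, Thm 3.11 p.416; Balaban1985Variational, (45) p.285, (110)–(111) p.294] -/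
theorem exists_H1k_frakGk_bound_of_small_field {η : ℝ} (hη : η ≠ 0) {a : ℝ} (ha : 0 < a) {Mφ Mφ' : ℝ} (hMφ : 0 ≤ Mφ) (hMφ' : 0 ≤ Mφ')
    (hφ : ∀ w, ‖φ w‖ ≤ Mφ * ‖w‖) (hφ' : ∀ X, ‖φ.symm X‖ ≤ Mφ' * ‖X‖) (τ : 𝔸 →ₗ[ℂ] ℂ) {Cτ : ℝ} (hτ : ∀ X, ‖τ X‖ ≤ Cτ * ‖X‖) (hCτ : 0 ≤ Cτ)
    {CS : ℝ} (hCS : 0 ≤ CS) :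
    ∃ CH CG ε₅ : ℝ, 0 < CH ∧ 0 < CG ∧ 0 < ε₅ ∧ ∀ (U : Bond d (towerP L m (n + 1)) → 𝔸ˣ)
      (hU1 : ∀ (j : ℕ) (x : B7Prop1Explicit.Site d) (κ : Fin d), perCfg (towerP L m (j + 1)) (UlevOf L m (n + 1) U j) x κ ∈ U1 𝔸)
      (hreg : ∀ (j : ℕ) (y : TSite d (towerP L m j)) (κ : Fin d) (r : Fin d → Fin L),
        ‖((Wcx L (perCfg (towerP L m (j + 1)) (UlevOf L m (n + 1) U j)) (cornerSite L y) κ (boxVec L r) : 𝔸ˣ) : 𝔸) - 1‖ ≤ α j)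
      (S₁ S₂ : (TSite d m → W) →ₗ[ℂ] SiteL2K ℂ d (towerP L m (n + 1)) c₀ W)
      {ε ρ' δQ : ℝ}, 0 ≤ ε → 0 ≤ ρ' → 0 ≤ δQ → ε + ρ' + δQ ≤ ε₅ →
      (∀ b, U b ∈ U1 𝔸) → (∀ b, ‖(U b : 𝔸) - 1‖ ≤ ε) →
      (∀ (b : Bond d (towerP L m (n + 1))) (v u : W), ⟪adTransportW φ U b v, u⟫_ℂ = ⟪v, adTransportW φ (fun b => (U b)⁻¹) b u⟫_ℂ) →
      (∀ f, QprimeTowerW L m n φ (fun _ : Bond d (towerP L m (n + 1)) => (1 : 𝔸ˣ)) (S₁ f) = f) →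
      (∀ f, QprimeTowerW L m n φ U (S₂ f) = f) → (∀ f, ‖S₁ f‖ ≤ CS * ‖f‖) → (∀ f, ‖S₂ f‖ ≤ CS * ‖f‖) →
      (∀ l : SiteL2K ℂ d (towerP L m (n + 1)) c₀ W,
        ‖QprimeTowerW L m n φ U l - QprimeTowerW L m n φ (fun _ : Bond d (towerP L m (n + 1)) => (1 : 𝔸ˣ)) l‖ ≤ ρ' * ‖l‖) →
      (∀ x : BondL2K ℂ d (towerP L m (n + 1)) c₀ W, ‖QkW L m n φ U hL α hα1 hU1 hreg (c₁ := c₁) x -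
        QkW L m n φ (fun _ : Bond d (towerP L m (n + 1)) => (1 : 𝔸ˣ)) hL (fun _ => 0) (fun _ => by norm_num)
          (perCfg_UlevOf_one_mem_U1 L m (n + 1)) (norm_Wcx_UlevOf_one_sub_one_le L m (n + 1) (fun _ => 0) (fun _ => le_rfl)) (c₁ := c₁) x‖ ≤
        δQ * ‖x‖) →
      ∀ (hpos : ∀ x : BondL2K ℂ d (towerP L m (n + 1)) c₀ W, x ≠ 0 →
          0 < RCLike.re ⟪x, laplaceAk L m n φ η U hL α hα1 hU1 hreg τ (c₀ := c₀) (c₁ := c₁) a x⟫_ℂ)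
        (hQ : Function.Surjective (QkW L m n φ U hL α hα1 hU1 hreg (c₀ := c₀) (c₁ := c₁))),
      (∀ b : BondL2K ℂ d m c₁ W, ‖H1LatticeK hpos hQ b‖ ≤ CH * ‖b‖) ∧
      (∀ x : BondL2K ℂ d (towerP L m (n + 1)) c₀ W, ‖frakGLatticeK hpos hQ x‖ ≤ CG * ‖x‖) := by
  have hc₀ : 0 < c₀ := Fact.out
  have hc : conj ((η : ℂ))⁻¹ = ((η : ℂ))⁻¹ := by rw [map_inv₀, Complex.conj_ofReal]
  -- the uniform coercivity of `Δ_a^{(k)}(U)` (§1)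
  obtain ⟨γ₁, ε₃, hγ₁, hε₃, Hc⟩ := exists_coercive_laplaceAk_of_small_field L m n hL φ (c₀ := c₀) (c₁ := c₁) α hα1 hη ha hMφ hMφ' hφ hφ' τ hτ hCτ hCS
  -- the flat averaging `Q_k(1)`: operator norm `MQ1` and the modulus `μQ1` of its adjoint
  obtain ⟨MQ1, hMQ1def⟩ : ∃ MQ1 : ℝ, MQ1 = ‖LinearMap.toContinuousLinearMap
    (QkW L m n φ (fun _ : Bond d (towerP L m (n + 1)) => (1 : 𝔸ˣ)) hL (fun _ => 0) (fun _ => by norm_num)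
      (perCfg_UlevOf_one_mem_U1 L m (n + 1)) (norm_Wcx_UlevOf_one_sub_one_le L m (n + 1) (fun _ => 0) (fun _ => le_rfl)) (c₀ := c₀) (c₁ := c₁))‖ :=
    ⟨_, rfl⟩
  have hMQ1 : 0 ≤ MQ1 := by rw [hMQ1def]; positivity
  have hQ1 : ∀ x : BondL2K ℂ d (towerP L m (n + 1)) c₀ W,
      ‖QkW L m n φ (fun _ : Bond d (towerP L m (n + 1)) => (1 : 𝔸ˣ)) hL (fun _ => 0) (fun _ => by norm_num)
        (perCfg_UlevOf_one_mem_U1 L m (n + 1)) (norm_Wcx_UlevOf_one_sub_one_le L m (n + 1) (fun _ => 0) (fun _ => le_rfl)) (c₀ := c₀) (c₁ := c₁) x‖ ≤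
      MQ1 * ‖x‖ := fun x => by
    rw [hMQ1def]
    exact (LinearMap.toContinuousLinearMap
      (QkW L m n φ (fun _ : Bond d (towerP L m (n + 1)) => (1 : 𝔸ˣ)) hL (fun _ => 0) (fun _ => by norm_num)
        (perCfg_UlevOf_one_mem_U1 L m (n + 1)) (norm_Wcx_UlevOf_one_sub_one_le L m (n + 1) (fun _ => 0) (fun _ => le_rfl))
        (c₀ := c₀) (c₁ := c₁))).le_opNorm x
  obtain ⟨μQ1, hμQ1, hQ1adj⟩ := exists_modulus_of_injective
    (LinearMap.adjoint (QkW L m n φ (fun _ : Bond d (towerP L m (n + 1)) => (1 : 𝔸ˣ)) hL (fun _ => 0) (fun _ => by norm_num)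
      (perCfg_UlevOf_one_mem_U1 L m (n + 1)) (norm_Wcx_UlevOf_one_sub_one_le L m (n + 1) (fun _ => 0) (fun _ => le_rfl)) (c₀ := c₀) (c₁ := c₁)))
    (adjoint_injective_of_surjective _ (QkW_one_surjective L m hL n φ))
  -- the constants
  obtain ⟨KR, hKRdef⟩ : ∃ KR : ℝ, KR = 2 * Mφ * Mφ' := ⟨_, rfl⟩
  have hKR : 0 ≤ KR := by rw [hKRdef]; positivity
  obtain ⟨MT, hMTdef⟩ : ∃ MT : ℝ, MT = 64 * d * ‖((η : ℂ))⁻¹‖ ^ 2 + 16 * ‖((η : ℂ))⁻¹‖ ^ 2 * d +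
      32 * d * Cτ * Mφ ^ 2 * (|η| ^ d / c₀) * (‖((η : ℂ))⁻¹‖ ^ 2 * (4 * 1)) + (MQ1 + 1) * (|a| * (MQ1 + 1)) + 1 := ⟨_, rfl⟩
  have hMT0 : 0 < MT := by rw [hMTdef]; positivity
  obtain ⟨MD, hMDdef⟩ : ∃ MD : ℝ, MD = 2 * (1 + 1) * ‖((η : ℂ))⁻¹‖ * Real.sqrt d := ⟨_, rfl⟩
  have hMD : 0 ≤ MD := by rw [hMDdef]; positivity
  refine ⟨γ₁⁻¹ * (MQ1 + 1) * (γ₁ * (μQ1 / 2) ^ 2 / MT ^ 2)⁻¹ + 1,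
    γ₁⁻¹ * (1 + (MQ1 + 1) * (γ₁ * (μQ1 / 2) ^ 2 / MT ^ 2)⁻¹ * (MQ1 + 1) * γ₁⁻¹ + MD * MD * γ₁⁻¹) + 1,
    min ε₃ (min (1 / (KR + 1)) (min 1 (μQ1 / 2))), by positivity, by positivity, by positivity, ?_⟩
  intro U hU1 hreg S₁ S₂ ε ρ' δQ hε hρ' hδQ ht hUb hUε hRS hS₁ hS₂ hS₁n hS₂n hQ' hQd hpos hQs
  have htε₃ : ε + ρ' + δQ ≤ ε₃ := ht.trans (min_le_left _ _)
  have hεt : ε ≤ ε + ρ' + δQ := by linarith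
  have hδQt : δQ ≤ ε + ρ' + δQ := by linarith
  have hε1' : ε ≤ 1 / (KR + 1) := hεt.trans (ht.trans ((min_le_right _ _).trans (min_le_left _ _)))
  have hδQ1 : δQ ≤ 1 := hδQt.trans (ht.trans ((min_le_right _ _).trans ((min_le_right _ _).trans (min_le_left _ _))))
  have hδQμ : δQ ≤ μQ1 / 2 := hδQt.trans (ht.trans ((min_le_right _ _).trans ((min_le_right _ _).trans (min_le_right _ _))))
  have hεR1 : 2 * Mφ * Mφ' * ε ≤ 1 := by
    rw [← hKRdef]
    refine (mul_le_mul_of_nonneg_left hε1' hKR).trans ?_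
    rw [mul_one_div, div_le_one (by positivity)]; linarith
  -- `Q_k(U)`: operator bound and modulus of its adjoint
  have hQU : ∀ x : BondL2K ℂ d (towerP L m (n + 1)) c₀ W, ‖QkW L m n φ U hL α hα1 hU1 hreg (c₀ := c₀) (c₁ := c₁) x‖ ≤ (MQ1 + 1) * ‖x‖ := fun x => by
    have h1 := hQ1 x
    have h2 := hQd x
    have h3 := norm_le_insert' (QkW L m n φ U hL α hα1 hU1 hreg (c₀ := c₀) (c₁ := c₁) x)
      (QkW L m n φ (fun _ : Bond d (towerP L m (n + 1)) => (1 : 𝔸ˣ)) hL (fun _ => 0) (fun _ => by norm_num)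
        (perCfg_UlevOf_one_mem_U1 L m (n + 1)) (norm_Wcx_UlevOf_one_sub_one_le L m (n + 1) (fun _ => 0) (fun _ => le_rfl)) (c₀ := c₀) (c₁ := c₁) x)
    have h4 : δQ * ‖x‖ ≤ 1 * ‖x‖ := mul_le_mul_of_nonneg_right hδQ1 (norm_nonneg x)
    linarith
  have hQUadj : ∀ y : BondL2K ℂ d m c₁ W, μQ1 / 2 * ‖y‖ ≤ ‖LinearMap.adjoint (QkW L m n φ U hL α hα1 hU1 hreg (c₀ := c₀) (c₁ := c₁)) y‖ := fun y => by
    have h1 := hQ1adj y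
    have h2 : ‖LinearMap.adjoint (QkW L m n φ U hL α hα1 hU1 hreg (c₀ := c₀) (c₁ := c₁) -
        QkW L m n φ (fun _ : Bond d (towerP L m (n + 1)) => (1 : 𝔸ˣ)) hL (fun _ => 0) (fun _ => by norm_num)
          (perCfg_UlevOf_one_mem_U1 L m (n + 1)) (norm_Wcx_UlevOf_one_sub_one_le L m (n + 1) (fun _ => 0) (fun _ => le_rfl)) (c₀ := c₀) (c₁ := c₁)) y‖ ≤
        δQ * ‖y‖ :=
      norm_adjoint_apply_le _ hδQ (fun x => by rw [LinearMap.sub_apply]; exact hQd x) y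
    rw [map_sub, LinearMap.sub_apply] at h2
    have h3 := norm_le_insert (LinearMap.adjoint (QkW L m n φ U hL α hα1 hU1 hreg (c₀ := c₀) (c₁ := c₁)) y)
      (LinearMap.adjoint (QkW L m n φ (fun _ : Bond d (towerP L m (n + 1)) => (1 : 𝔸ˣ)) hL (fun _ => 0) (fun _ => by norm_num)
        (perCfg_UlevOf_one_mem_U1 L m (n + 1)) (norm_Wcx_UlevOf_one_sub_one_le L m (n + 1) (fun _ => 0) (fun _ => le_rfl)) (c₀ := c₀) (c₁ := c₁)) y)
    have h4 : δQ * ‖y‖ ≤ μQ1 / 2 * ‖y‖ := mul_le_mul_of_nonneg_right hδQμ (norm_nonneg _)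
    linarith
  -- the operator bound of `Δ_a^{(k)}(U)` and its letters in the `laplaceAK` form
  have hMTU := norm_laplaceAk_le L m n hL φ α hα1 hMφ hMφ' hφ hφ' τ hτ hCτ (η := η) a U hU1 hreg hUb hε hεR1 hUε hRS (by positivity) hQU
  have hMT : ∀ x : BondL2K ℂ d (towerP L m (n + 1)) c₀ W,
      ‖B11Eq103H1Complex.laplaceAK (hessOp φ η U τ) (covDerivL2K ℂ c₀ ((η : ℂ))⁻¹ (adTransportW φ U)) (RofUk L m n φ η U)
        (covDivL2K ℂ c₀ ((η : ℂ))⁻¹ (adTransportW φ fun b => (U b)⁻¹)) (QkW L m n φ U hL α hα1 hU1 hreg (c₀ := c₀) (c₁ := c₁))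
        (LinearMap.adjoint (QkW L m n φ U hL α hα1 hU1 hreg (c₀ := c₀) (c₁ := c₁))) (RCLike.ofReal a) x‖ ≤ MT * ‖x‖ := fun x => by
    refine (hMTU x).trans (mul_le_mul_of_nonneg_right ?_ (norm_nonneg _))
    rw [hMTdef]
    have hε1 : ε ≤ 1 := by
      have := hεt.trans (ht.trans ((min_le_right _ _).trans ((min_le_right _ _).trans (min_le_left _ _)))); exact this
    have h1 : 32 * d * Cτ * Mφ ^ 2 * (|η| ^ d / c₀) * (‖((η : ℂ))⁻¹‖ ^ 2 * (4 * ε)) ≤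
        32 * d * Cτ * Mφ ^ 2 * (|η| ^ d / c₀) * (‖((η : ℂ))⁻¹‖ ^ 2 * (4 * 1)) := by gcongr
    linarith
  have hcoer : ∀ x : BondL2K ℂ d (towerP L m (n + 1)) c₀ W, γ₁ * ‖x‖ ^ 2 ≤ RCLike.re ⟪x,
      B11Eq103H1Complex.laplaceAK (hessOp φ η U τ) (covDerivL2K ℂ c₀ ((η : ℂ))⁻¹ (adTransportW φ U)) (RofUk L m n φ η U)
        (covDivL2K ℂ c₀ ((η : ℂ))⁻¹ (adTransportW φ fun b => (U b)⁻¹)) (QkW L m n φ U hL α hα1 hU1 hreg (c₀ := c₀) (c₁ := c₁))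
        (LinearMap.adjoint (QkW L m n φ U hL α hα1 hU1 hreg (c₀ := c₀) (c₁ := c₁))) (RCLike.ofReal a) x⟫_ℂ :=
    fun x => Hc U hU1 hreg S₁ S₂ hε hρ' hδQ htε₃ hUb hUε hRS hS₁ hS₂ hS₁n hS₂n hQ' hQd x
  have hpos' : ∀ x : BondL2K ℂ d (towerP L m (n + 1)) c₀ W, x ≠ 0 → 0 < RCLike.re ⟪x,
      B11Eq103H1Complex.laplaceAK (hessOp φ η U τ) (covDerivL2K ℂ c₀ ((η : ℂ))⁻¹ (adTransportW φ U)) (RofUk L m n φ η U)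
        (covDivL2K ℂ c₀ ((η : ℂ))⁻¹ (adTransportW φ fun b => (U b)⁻¹)) (QkW L m n φ U hL α hα1 hU1 hreg (c₀ := c₀) (c₁ := c₁))
        (LinearMap.adjoint (QkW L m n φ U hL α hα1 hU1 hreg (c₀ := c₀) (c₁ := c₁))) (RCLike.ofReal a) x⟫_ℂ := hpos
  have hμ2 : 0 < μQ1 / 2 := by positivity
  have hR1 : ∀ (b : Bond d (towerP L m (n + 1))) (w : W), ‖adTransportW φ U b w - w‖ ≤ 1 * ‖w‖ := fun b w =>
    (norm_adTransportW_sub_le φ hφ hφ' hMφ' U b (hUb b) (hUε b) w).trans (mul_le_mul_of_nonneg_right hεR1 (norm_nonneg _))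
  have hD : ∀ s : SiteL2K ℂ d (towerP L m (n + 1)) c₀ W, ‖covDerivL2K ℂ c₀ ((η : ℂ))⁻¹ (adTransportW φ U) s‖ ≤ MD * ‖s‖ := fun s => by
    rw [hMDdef]; exact norm_covDerivL2K_le _ zero_le_one hR1 s
  have hDs : ∀ x : BondL2K ℂ d (towerP L m (n + 1)) c₀ W, ‖covDivL2K ℂ c₀ ((η : ℂ))⁻¹ (adTransportW φ fun b => (U b)⁻¹) x‖ ≤ MD * ‖x‖ := fun x => by
    rw [hMDdef]; exact norm_covDivL2K_le _ hc zero_le_one hR1 hRS x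
  have hRle : ∀ s : SiteL2K ℂ d (towerP L m (n + 1)) c₀ W, ‖RofUk L m n φ η U s‖ ≤ ‖s‖ := fun s => by
    unfold RofUk B11Eq103H1Complex.RLatticeK; exact norm_projR_le _ _ s
  refine ⟨fun b => ?_, fun x => ?_⟩
  · have h := norm_H1K_le (𝕜 := ℂ) (E := BondL2K ℂ d (towerP L m (n + 1)) c₀ W) (F := BondL2K ℂ d m c₁ W) (S := SiteL2K ℂ d (towerP L m (n + 1)) c₀ W)
      (Δ := hessOp φ η U τ (c₀ := c₀)) (D := covDerivL2K ℂ c₀ ((η : ℂ))⁻¹ (adTransportW φ U)) (R := RofUk L m n φ η U (c₀ := c₀))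
      (Dstar := covDivL2K ℂ c₀ ((η : ℂ))⁻¹ (adTransportW φ fun b => (U b)⁻¹)) (Q := QkW L m n φ U hL α hα1 hU1 hreg (c₀ := c₀) (c₁ := c₁))
      (a := RCLike.ofReal a) (γ := γ₁) (MT := MT) (MQ := MQ1 + 1) (μQ := μQ1 / 2) hγ₁ hcoer hMT hpos' (by positivity) hμ2 hQU hQUadj
      (fun x' y' => (LinearMap.adjoint_inner_right _ x' y').symm) (adjoint_injective_of_modulus hμ2 hQUadj) hMT0 b
    have h' : ‖H1LatticeK hpos hQs b‖ ≤ γ₁⁻¹ * (MQ1 + 1) * (γ₁ * (μQ1 / 2) ^ 2 / MT ^ 2)⁻¹ * ‖b‖ := h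
    exact h'.trans (mul_le_mul_of_nonneg_right (le_add_of_nonneg_right zero_le_one) (norm_nonneg b))
  · have h := norm_frakGLin_le (𝕜 := ℂ) (E := BondL2K ℂ d (towerP L m (n + 1)) c₀ W) (F := BondL2K ℂ d m c₁ W) (S := SiteL2K ℂ d (towerP L m (n + 1)) c₀ W)
      (Δ := hessOp φ η U τ (c₀ := c₀)) (D := covDerivL2K ℂ c₀ ((η : ℂ))⁻¹ (adTransportW φ U)) (R := RofUk L m n φ η U (c₀ := c₀))
      (Dstar := covDivL2K ℂ c₀ ((η : ℂ))⁻¹ (adTransportW φ fun b => (U b)⁻¹)) (Q := QkW L m n φ U hL α hα1 hU1 hreg (c₀ := c₀) (c₁ := c₁))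
      (a := RCLike.ofReal a) (γ := γ₁) (MT := MT) (MQ := MQ1 + 1) (μQ := μQ1 / 2) (MD := MD) hγ₁ hcoer hMT hpos' (by positivity) hμ2 hQU hQUadj
      (fun x' y' => (LinearMap.adjoint_inner_right _ x' y').symm) (adjoint_injective_of_modulus hμ2 hQUadj) hMD hD hDs hRle hMT0 x
    have h' : ‖frakGLatticeK hpos hQs x‖ ≤ γ₁⁻¹ * (1 + (MQ1 + 1) * (γ₁ * (μQ1 / 2) ^ 2 / MT ^ 2)⁻¹ * (MQ1 + 1) * γ₁⁻¹ + MD * MD * γ₁⁻¹) * ‖x‖ := h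
    exact h'.trans (mul_le_mul_of_nonneg_right (le_add_of_nonneg_right zero_le_one) (norm_nonneg x))

/-! ## §4 The (N)-reading: `H_{1,k}(U)`, `𝔊_k(U)` bounded in the chart's type `NegSize → Space115 … (∇_U)`, uniformly over the small fields -/

/-- **THE `k`-LEVEL CHART LETTERS `H_{1,k}(U)`, `𝔊_k(U)` IN THE TYPE `NegSize → Space115 … (∇_U)` ARE BOUNDED UNIFORMLY OVER THE SMALL FIELDS OF A
FIXED LATTICE** ([5] (3.126) `HB = GQ*(QGQ*)⁻¹B`, (3.153) `𝔊 = G𝔓*`, read in [B11] (117)'s «norm max{|·|_(−1), |∇·|_(−2)} of the transformation»), for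
print's `k`-th-step operator: `∀ CS ≥ 0`, for FIXED level maps, `∃ C_H′ C_G′ ε₅ > 0` such that for EVERY background of the tower's displayed data with
`ε + ρ′ + δ_Q ≤ ε₅`, and ANY `hpos`, `hQ`: `‖H1LatticeCLM φ hpos hQ lev₁ (nabla115 η U)‖ ≤ C_H′`, `‖frakGLatticeCLM φ hpos hQ lev₁ (nabla115 η U)‖ ≤ C_G′`.
Inputs: §3; `B11Eq117TransformationNorm.norm_H1CLM_le` ∕ `norm_frakG_fun_le`; `‖∇_U‖_∞→∞ ≤ 2|η|⁻¹` (`norm_nabla115_le`, unit-bounded `U`).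
Finite-lattice constants (depending also on `k`, `CS`); NOT print's lattice-uniform `B₀`.
[cite: Balaban1985BackgroundPropagators, (3.126) p.420, (3.153) p.426, Thm 3.11 p.416, Thm 3.13 p.426; Balaban1985Variational, (103) p.293, (115) p.294, (117) p.295] -/
theorem exists_H1k_frakGk_CLM_bound_of_small_field [FiniteDimensional ℂ 𝔸] {η : ℝ} [Fact (0 < (L : ℝ))] [Fact (0 < η)]
    (lev₀ : Bond d (towerP L m (n + 1)) → ℕ) (levB : Bond d m → ℕ) (lev₁ : Bond d (towerP L m (n + 1)) × Fin d → ℕ)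
    {a : ℝ} (ha : 0 < a) {Mφ Mφ' : ℝ} (hMφ : 0 ≤ Mφ) (hMφ' : 0 ≤ Mφ')
    (hφ : ∀ w, ‖φ w‖ ≤ Mφ * ‖w‖) (hφ' : ∀ X, ‖φ.symm X‖ ≤ Mφ' * ‖X‖) (τ : 𝔸 →ₗ[ℂ] ℂ) {Cτ : ℝ} (hτ : ∀ X, ‖τ X‖ ≤ Cτ * ‖X‖) (hCτ : 0 ≤ Cτ)
    {CS : ℝ} (hCS : 0 ≤ CS) :
    ∃ CH' CG' ε₅ : ℝ, 0 < CH' ∧ 0 < CG' ∧ 0 < ε₅ ∧ ∀ (U : Bond d (towerP L m (n + 1)) → 𝔸ˣ)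
      (hU1 : ∀ (j : ℕ) (x : B7Prop1Explicit.Site d) (κ : Fin d), perCfg (towerP L m (j + 1)) (UlevOf L m (n + 1) U j) x κ ∈ U1 𝔸)
      (hreg : ∀ (j : ℕ) (y : TSite d (towerP L m j)) (κ : Fin d) (r : Fin d → Fin L),
        ‖((Wcx L (perCfg (towerP L m (j + 1)) (UlevOf L m (n + 1) U j)) (cornerSite L y) κ (boxVec L r) : 𝔸ˣ) : 𝔸) - 1‖ ≤ α j)
      (S₁ S₂ : (TSite d m → W) →ₗ[ℂ] SiteL2K ℂ d (towerP L m (n + 1)) c₀ W)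
      {ε ρ' δQ : ℝ}, 0 ≤ ε → 0 ≤ ρ' → 0 ≤ δQ → ε + ρ' + δQ ≤ ε₅ →
      (∀ b, U b ∈ U1 𝔸) → (∀ b, ‖(U b : 𝔸) - 1‖ ≤ ε) →
      (∀ (b : Bond d (towerP L m (n + 1))) (v u : W), ⟪adTransportW φ U b v, u⟫_ℂ = ⟪v, adTransportW φ (fun b => (U b)⁻¹) b u⟫_ℂ) →
      (∀ f, QprimeTowerW L m n φ (fun _ : Bond d (towerP L m (n + 1)) => (1 : 𝔸ˣ)) (S₁ f) = f) →
      (∀ f, QprimeTowerW L m n φ U (S₂ f) = f) → (∀ f, ‖S₁ f‖ ≤ CS * ‖f‖) → (∀ f, ‖S₂ f‖ ≤ CS * ‖f‖) →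
      (∀ l : SiteL2K ℂ d (towerP L m (n + 1)) c₀ W,
        ‖QprimeTowerW L m n φ U l - QprimeTowerW L m n φ (fun _ : Bond d (towerP L m (n + 1)) => (1 : 𝔸ˣ)) l‖ ≤ ρ' * ‖l‖) →
      (∀ x : BondL2K ℂ d (towerP L m (n + 1)) c₀ W, ‖QkW L m n φ U hL α hα1 hU1 hreg (c₁ := c₁) x -
        QkW L m n φ (fun _ : Bond d (towerP L m (n + 1)) => (1 : 𝔸ˣ)) hL (fun _ => 0) (fun _ => by norm_num)
          (perCfg_UlevOf_one_mem_U1 L m (n + 1)) (norm_Wcx_UlevOf_one_sub_one_le L m (n + 1) (fun _ => 0) (fun _ => le_rfl)) (c₁ := c₁) x‖ ≤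
        δQ * ‖x‖) →
      ∀ (hpos : ∀ x : BondL2K ℂ d (towerP L m (n + 1)) c₀ W, x ≠ 0 →
          0 < RCLike.re ⟪x, laplaceAk L m n φ η U hL α hα1 hU1 hreg τ (c₀ := c₀) (c₁ := c₁) a x⟫_ℂ)
        (hQ : Function.Surjective (QkW L m n φ U hL α hα1 hU1 hreg (c₀ := c₀) (c₁ := c₁))),
      ‖H1LatticeCLM (L := (L : ℝ)) (η := η) (lev₀ := lev₀) (levB := levB) φ hpos hQ lev₁ (nabla115 η U)‖ ≤ CH' ∧
      ‖frakGLatticeCLM (L := (L : ℝ)) (η := η) (lev₀ := lev₀) φ hpos hQ lev₁ (nabla115 η U)‖ ≤ CG' := by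
  have hη : η ≠ 0 := ne_of_gt (Fact.out : 0 < η)
  obtain ⟨CH, CG, ε₅, hCH, hCG, hε₅, H⟩ :=
    exists_H1k_frakGk_bound_of_small_field L m n hL φ (c₀ := c₀) (c₁ := c₁) α hα1 hη ha hMφ hMφ' hφ hφ' τ hτ hCτ hCS
  -- the U-independent comparison constants
  obtain ⟨MD, hMDdef⟩ : ∃ MD : ℝ, MD = 2 * ‖((η : ℂ))⁻¹‖ := ⟨_, rfl⟩
  obtain ⟨K, hKdef⟩ : ∃ K : ℝ, K = max (B11Eq115Space.NegSup.wSup (levWeight (L : ℝ) η lev₀ 1) : ℝ)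
      (B11Eq115Space.NegSup.wSup (levWeight (L : ℝ) η lev₁ 2) * MD) := ⟨_, rfl⟩
  have hK : 0 ≤ K := by rw [hKdef]; exact le_max_of_le_left (B11Eq115Space.NegSup.wSup (levWeight (L : ℝ) η lev₀ 1)).coe_nonneg
  refine ⟨K * (Mφ * CH * (Real.sqrt (c₁ * Fintype.card (Bond d m)) * Mφ') / Real.sqrt c₀) *
      B11Eq115Space.NegSup.wInvSup (levWeight (L : ℝ) η levB 0) + 1,
    K * (Mφ * CG * (Real.sqrt (c₀ * Fintype.card (Bond d (towerP L m (n + 1)))) * Mφ') / Real.sqrt c₀) *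
      B11Eq115Space.NegSup.wInvSup (levWeight (L : ℝ) η lev₀ 3) + 1,
    ε₅, by positivity, by positivity, hε₅, ?_⟩
  intro U hU1 hreg S₁ S₂ ε ρ' δQ hε hρ' hδQ ht hUb hUε hRS hS₁ hS₂ hS₁n hS₂n hQ' hQd hpos hQs
  obtain ⟨hH1, hG⟩ := H U hU1 hreg S₁ S₂ hε hρ' hδQ ht hUb hUε hRS hS₁ hS₂ hS₁n hS₂n hQ' hQd hpos hQs
  -- `‖∇_U‖ ≤ 2|η|⁻¹` from the unit-boundedness of the bond variables
  have hUb' : ∀ b : Bond d (towerP L m (n + 1)), ‖(U b : 𝔸)‖ ≤ 1 ∧ ‖(((U b)⁻¹ : 𝔸ˣ) : 𝔸)‖ ≤ 1 := fun b =>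
    B7Prop1Explicit.mem_U1.1 (hUb b)
  have hD : ∀ g : Bond d (towerP L m (n + 1)) → 𝔸, ‖nabla115 η U g‖ ≤ MD * ‖g‖ := fun g => by
    rw [hMDdef]; exact norm_nabla115_le η U hUb' g
  refine ⟨?_, ?_⟩
  · have h := norm_H1CLM_le (L := (L : ℝ)) (η := η) (lev₀ := lev₀) (levB := levB) φ hMφ hφ hMφ' hφ' lev₁ (nabla115 η U)
      (H1LatticeK hpos hQs) hCH.le hH1 hD
    rw [← hKdef] at h
    exact h.trans (le_add_of_nonneg_right zero_le_one)
  · have hG' : ∀ x : BondL2K ℂ d (towerP L m (n + 1)) c₀ W,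
        ‖B11Eq111FrakG.frakGLin (G1LatticeK hpos) (QkW L m n φ U hL α hα1 hU1 hreg (c₀ := c₀) (c₁ := c₁))
          (LinearMap.adjoint (QkW L m n φ U hL α hα1 hU1 hreg (c₀ := c₀) (c₁ := c₁))) (KinvLatticeK hpos hQs)
          (covDerivL2K ℂ c₀ ((η : ℂ))⁻¹ (adTransportW φ U)) (RofUk L m n φ η U)
          (covDivL2K ℂ c₀ ((η : ℂ))⁻¹ (adTransportW φ fun b => (U b)⁻¹)) x‖ ≤ CG * ‖x‖ := hG
    have h := norm_frakG_fun_le (L := (L : ℝ)) (η := η) (lev₀ := lev₀) φ hMφ hφ hMφ' hφ' lev₁ (nabla115 η U) (G1LatticeK hpos)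
      (QkW L m n φ U hL α hα1 hU1 hreg (c₀ := c₀) (c₁ := c₁)) (KinvLatticeK hpos hQs) (covDerivL2K ℂ c₀ ((η : ℂ))⁻¹ (adTransportW φ U))
      (RofUk L m n φ η U) (covDivL2K ℂ c₀ ((η : ℂ))⁻¹ (adTransportW φ fun b => (U b)⁻¹)) hCG.le hG' hD
    rw [← hKdef] at h
    exact h.trans (le_add_of_nonneg_right zero_le_one)


/-! ## §5 The sections `(S₁, S₂, CS)` DISCHARGED by the universal right inverse of `Q′_k` (APPEND v1.2, NE9 leaf-02 gen 63, OWNER W-16 «leaf-02 appends») -/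

section SectionsFree

open B9Eq319QprimeTowerCentre (exists_QprimeTowerW_rightInverse)

/-- **§1 SECTIONS-FREE — PRINT's `k`-LEVEL `Δ_a(U)` UNIFORMLY COERCIVE AT EVERY SMALL FIELD OF A FIXED LATTICE, modulo the tower averaging
letters `ρ′`, `δ_Q` ONLY**: `exists_coercive_laplaceAk_of_small_field` with the right-inverse binders `(S₁ S₂ …) hS₁ hS₂ hS₁n hS₂n` and the parameter
`CS` DISCHARGED by NE9 leaf-02's universal section `B9Eq319QprimeTowerCentre.exists_QprimeTowerW_rightInverse` (one `φ`∕`U`-free linear `S`,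
`Q′_k(U) ∘ S = id`; `S₁ = S₂ = S`, `CS := (L^d)^{n+1}·√(c₀·#T_m)` fixed BEFORE `∃ γ₁ ε₃` — still finite-lattice numbers). [folklore composition BY NAME]
[cite: Balaban1985BackgroundPropagators, Thm 3.11 p.416, (3.69) p.404, (3.26) p.395, (3.15)/(3.19) p.393] -/
theorem exists_coercive_laplaceAk_of_small_field' {η : ℝ} (hη : η ≠ 0) {a : ℝ} (ha : 0 < a) {Mφ Mφ' : ℝ} (hMφ : 0 ≤ Mφ) (hMφ' : 0 ≤ Mφ')
    (hφ : ∀ w, ‖φ w‖ ≤ Mφ * ‖w‖) (hφ' : ∀ X, ‖φ.symm X‖ ≤ Mφ' * ‖X‖) (τ : 𝔸 →ₗ[ℂ] ℂ) {Cτ : ℝ} (hτ : ∀ X, ‖τ X‖ ≤ Cτ * ‖X‖) (hCτ : 0 ≤ Cτ) :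
    ∃ γ₁ ε₃ : ℝ, 0 < γ₁ ∧ 0 < ε₃ ∧ ∀ (U : Bond d (towerP L m (n + 1)) → 𝔸ˣ)
      (hU1 : ∀ (j : ℕ) (x : B7Prop1Explicit.Site d) (κ : Fin d), perCfg (towerP L m (j + 1)) (UlevOf L m (n + 1) U j) x κ ∈ U1 𝔸)
      (hreg : ∀ (j : ℕ) (y : TSite d (towerP L m j)) (κ : Fin d) (r : Fin d → Fin L),
        ‖((Wcx L (perCfg (towerP L m (j + 1)) (UlevOf L m (n + 1) U j)) (cornerSite L y) κ (boxVec L r) : 𝔸ˣ) : 𝔸) - 1‖ ≤ α j)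
      {ε ρ' δQ : ℝ}, 0 ≤ ε → 0 ≤ ρ' → 0 ≤ δQ → ε + ρ' + δQ ≤ ε₃ →
      (∀ b, U b ∈ U1 𝔸) → (∀ b, ‖(U b : 𝔸) - 1‖ ≤ ε) →
      (∀ (b : Bond d (towerP L m (n + 1))) (v u : W), ⟪adTransportW φ U b v, u⟫_ℂ = ⟪v, adTransportW φ (fun b => (U b)⁻¹) b u⟫_ℂ) →
      (∀ l : SiteL2K ℂ d (towerP L m (n + 1)) c₀ W,
        ‖QprimeTowerW L m n φ U l - QprimeTowerW L m n φ (fun _ : Bond d (towerP L m (n + 1)) => (1 : 𝔸ˣ)) l‖ ≤ ρ' * ‖l‖) →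
      (∀ x : BondL2K ℂ d (towerP L m (n + 1)) c₀ W, ‖QkW L m n φ U hL α hα1 hU1 hreg (c₁ := c₁) x -
        QkW L m n φ (fun _ : Bond d (towerP L m (n + 1)) => (1 : 𝔸ˣ)) hL (fun _ => 0) (fun _ => by norm_num)
          (perCfg_UlevOf_one_mem_U1 L m (n + 1)) (norm_Wcx_UlevOf_one_sub_one_le L m (n + 1) (fun _ => 0) (fun _ => le_rfl)) (c₁ := c₁) x‖ ≤
        δQ * ‖x‖) →
      ∀ x : BondL2K ℂ d (towerP L m (n + 1)) c₀ W, γ₁ * ‖x‖ ^ 2 ≤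
        RCLike.re ⟪x, laplaceAk L m n φ η U hL α hα1 hU1 hreg τ (c₀ := c₀) (c₁ := c₁) a x⟫_ℂ := by
  obtain ⟨S, hS, -, hSn⟩ := exists_QprimeTowerW_rightInverse L m n (𝔸 := 𝔸) (W := W) (c₀ := c₀)
  have hCS : (0 : ℝ) ≤ ((L : ℝ) ^ d) ^ (n + 1) * Real.sqrt (c₀ * Fintype.card (TSite d m)) := by positivity
  obtain ⟨γ₁, ε₃, hγ₁, hε₃, H⟩ :=
    exists_coercive_laplaceAk_of_small_field L m n hL φ (c₀ := c₀) (c₁ := c₁) α hα1 hη ha hMφ hMφ' hφ hφ' τ hτ hCτ hCS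
  exact ⟨γ₁, ε₃, hγ₁, hε₃, fun U hU1 hreg ε ρ' δQ hε hρ' hδQ ht hUb hUε hRS hQ' hQ x =>
    H U hU1 hreg S S hε hρ' hδQ ht hUb hUε hRS (hS φ _) (hS φ U) hSn hSn hQ' hQ x⟩

/-- **§3 SECTIONS-FREE — `H_{1,k}(U)`, `𝔊_k(U)` BOUNDED UNIFORMLY OVER THE SMALL FIELDS OF A FIXED LATTICE, modulo `ρ′`, `δ_Q` ONLY**:
`exists_H1k_frakGk_bound_of_small_field` with `(S₁ S₂ …) hS₁ hS₂ hS₁n hS₂n` and `CS` DISCHARGED the same way (`C_H`, `C_G`, `ε₅` before `∀ U`).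
[folklore composition BY NAME] [cite: Balaban1985BackgroundPropagators, (3.126) p.420, (3.153) p.426, Thm 3.4 p.400, Thm 3.11 p.416; Balaban1985Variational, (45) p.285, (110)–(111) p.294] -/
theorem exists_H1k_frakGk_bound_of_small_field' {η : ℝ} (hη : η ≠ 0) {a : ℝ} (ha : 0 < a) {Mφ Mφ' : ℝ} (hMφ : 0 ≤ Mφ) (hMφ' : 0 ≤ Mφ')
    (hφ : ∀ w, ‖φ w‖ ≤ Mφ * ‖w‖) (hφ' : ∀ X, ‖φ.symm X‖ ≤ Mφ' * ‖X‖) (τ : 𝔸 →ₗ[ℂ] ℂ) {Cτ : ℝ} (hτ : ∀ X, ‖τ X‖ ≤ Cτ * ‖X‖) (hCτ : 0 ≤ Cτ) :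
    ∃ CH CG ε₅ : ℝ, 0 < CH ∧ 0 < CG ∧ 0 < ε₅ ∧ ∀ (U : Bond d (towerP L m (n + 1)) → 𝔸ˣ)
      (hU1 : ∀ (j : ℕ) (x : B7Prop1Explicit.Site d) (κ : Fin d), perCfg (towerP L m (j + 1)) (UlevOf L m (n + 1) U j) x κ ∈ U1 𝔸)
      (hreg : ∀ (j : ℕ) (y : TSite d (towerP L m j)) (κ : Fin d) (r : Fin d → Fin L),
        ‖((Wcx L (perCfg (towerP L m (j + 1)) (UlevOf L m (n + 1) U j)) (cornerSite L y) κ (boxVec L r) : 𝔸ˣ) : 𝔸) - 1‖ ≤ α j)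
      {ε ρ' δQ : ℝ}, 0 ≤ ε → 0 ≤ ρ' → 0 ≤ δQ → ε + ρ' + δQ ≤ ε₅ →
      (∀ b, U b ∈ U1 𝔸) → (∀ b, ‖(U b : 𝔸) - 1‖ ≤ ε) →
      (∀ (b : Bond d (towerP L m (n + 1))) (v u : W), ⟪adTransportW φ U b v, u⟫_ℂ = ⟪v, adTransportW φ (fun b => (U b)⁻¹) b u⟫_ℂ) →
      (∀ l : SiteL2K ℂ d (towerP L m (n + 1)) c₀ W,
        ‖QprimeTowerW L m n φ U l - QprimeTowerW L m n φ (fun _ : Bond d (towerP L m (n + 1)) => (1 : 𝔸ˣ)) l‖ ≤ ρ' * ‖l‖) →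
      (∀ x : BondL2K ℂ d (towerP L m (n + 1)) c₀ W, ‖QkW L m n φ U hL α hα1 hU1 hreg (c₁ := c₁) x -
        QkW L m n φ (fun _ : Bond d (towerP L m (n + 1)) => (1 : 𝔸ˣ)) hL (fun _ => 0) (fun _ => by norm_num)
          (perCfg_UlevOf_one_mem_U1 L m (n + 1)) (norm_Wcx_UlevOf_one_sub_one_le L m (n + 1) (fun _ => 0) (fun _ => le_rfl)) (c₁ := c₁) x‖ ≤
        δQ * ‖x‖) →
      ∀ (hpos : ∀ x : BondL2K ℂ d (towerP L m (n + 1)) c₀ W, x ≠ 0 →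
          0 < RCLike.re ⟪x, laplaceAk L m n φ η U hL α hα1 hU1 hreg τ (c₀ := c₀) (c₁ := c₁) a x⟫_ℂ)
        (hQ : Function.Surjective (QkW L m n φ U hL α hα1 hU1 hreg (c₀ := c₀) (c₁ := c₁))),
      (∀ b : BondL2K ℂ d m c₁ W, ‖H1LatticeK hpos hQ b‖ ≤ CH * ‖b‖) ∧
      (∀ x : BondL2K ℂ d (towerP L m (n + 1)) c₀ W, ‖frakGLatticeK hpos hQ x‖ ≤ CG * ‖x‖) := by
  obtain ⟨S, hS, -, hSn⟩ := exists_QprimeTowerW_rightInverse L m n (𝔸 := 𝔸) (W := W) (c₀ := c₀)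
  have hCS : (0 : ℝ) ≤ ((L : ℝ) ^ d) ^ (n + 1) * Real.sqrt (c₀ * Fintype.card (TSite d m)) := by positivity
  obtain ⟨CH, CG, ε₅, hCH, hCG, hε₅, H⟩ :=
    exists_H1k_frakGk_bound_of_small_field L m n hL φ (c₀ := c₀) (c₁ := c₁) α hα1 hη ha hMφ hMφ' hφ hφ' τ hτ hCτ hCS
  exact ⟨CH, CG, ε₅, hCH, hCG, hε₅, fun U hU1 hreg ε ρ' δQ hε hρ' hδQ ht hUb hUε hRS hQ' hQd hpos hQs =>
    H U hU1 hreg S S hε hρ' hδQ ht hUb hUε hRS (hS φ _) (hS φ U) hSn hSn hQ' hQd hpos hQs⟩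

/-- **§4 SECTIONS-FREE — THE (N)-READING: `‖H1LatticeCLM …‖ ≤ C_H′`, `‖frakGLatticeCLM …‖ ≤ C_G′` UNIFORMLY OVER THE SMALL FIELDS, modulo `ρ′`, `δ_Q`
ONLY**: `exists_H1k_frakGk_CLM_bound_of_small_field` with the sections DISCHARGED the same way.
[folklore composition BY NAME] [cite: Balaban1985BackgroundPropagators, (3.126) p.420, (3.153) p.426, Thm 3.11 p.416, Thm 3.13 p.426; Balaban1985Variational, (103) p.293, (115) p.294, (117) p.295] -/
theorem exists_H1k_frakGk_CLM_bound_of_small_field' [FiniteDimensional ℂ 𝔸] {η : ℝ} [Fact (0 < (L : ℝ))] [Fact (0 < η)]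
    (lev₀ : Bond d (towerP L m (n + 1)) → ℕ) (levB : Bond d m → ℕ) (lev₁ : Bond d (towerP L m (n + 1)) × Fin d → ℕ)
    {a : ℝ} (ha : 0 < a) {Mφ Mφ' : ℝ} (hMφ : 0 ≤ Mφ) (hMφ' : 0 ≤ Mφ')
    (hφ : ∀ w, ‖φ w‖ ≤ Mφ * ‖w‖) (hφ' : ∀ X, ‖φ.symm X‖ ≤ Mφ' * ‖X‖) (τ : 𝔸 →ₗ[ℂ] ℂ) {Cτ : ℝ} (hτ : ∀ X, ‖τ X‖ ≤ Cτ * ‖X‖) (hCτ : 0 ≤ Cτ) :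
    ∃ CH' CG' ε₅ : ℝ, 0 < CH' ∧ 0 < CG' ∧ 0 < ε₅ ∧ ∀ (U : Bond d (towerP L m (n + 1)) → 𝔸ˣ)
      (hU1 : ∀ (j : ℕ) (x : B7Prop1Explicit.Site d) (κ : Fin d), perCfg (towerP L m (j + 1)) (UlevOf L m (n + 1) U j) x κ ∈ U1 𝔸)
      (hreg : ∀ (j : ℕ) (y : TSite d (towerP L m j)) (κ : Fin d) (r : Fin d → Fin L),
        ‖((Wcx L (perCfg (towerP L m (j + 1)) (UlevOf L m (n + 1) U j)) (cornerSite L y) κ (boxVec L r) : 𝔸ˣ) : 𝔸) - 1‖ ≤ α j)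
      {ε ρ' δQ : ℝ}, 0 ≤ ε → 0 ≤ ρ' → 0 ≤ δQ → ε + ρ' + δQ ≤ ε₅ →
      (∀ b, U b ∈ U1 𝔸) → (∀ b, ‖(U b : 𝔸) - 1‖ ≤ ε) →
      (∀ (b : Bond d (towerP L m (n + 1))) (v u : W), ⟪adTransportW φ U b v, u⟫_ℂ = ⟪v, adTransportW φ (fun b => (U b)⁻¹) b u⟫_ℂ) →
      (∀ l : SiteL2K ℂ d (towerP L m (n + 1)) c₀ W,
        ‖QprimeTowerW L m n φ U l - QprimeTowerW L m n φ (fun _ : Bond d (towerP L m (n + 1)) => (1 : 𝔸ˣ)) l‖ ≤ ρ' * ‖l‖) →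
      (∀ x : BondL2K ℂ d (towerP L m (n + 1)) c₀ W, ‖QkW L m n φ U hL α hα1 hU1 hreg (c₁ := c₁) x -
        QkW L m n φ (fun _ : Bond d (towerP L m (n + 1)) => (1 : 𝔸ˣ)) hL (fun _ => 0) (fun _ => by norm_num)
          (perCfg_UlevOf_one_mem_U1 L m (n + 1)) (norm_Wcx_UlevOf_one_sub_one_le L m (n + 1) (fun _ => 0) (fun _ => le_rfl)) (c₁ := c₁) x‖ ≤
        δQ * ‖x‖) →
      ∀ (hpos : ∀ x : BondL2K ℂ d (towerP L m (n + 1)) c₀ W, x ≠ 0 →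
          0 < RCLike.re ⟪x, laplaceAk L m n φ η U hL α hα1 hU1 hreg τ (c₀ := c₀) (c₁ := c₁) a x⟫_ℂ)
        (hQ : Function.Surjective (QkW L m n φ U hL α hα1 hU1 hreg (c₀ := c₀) (c₁ := c₁))),
      ‖H1LatticeCLM (L := (L : ℝ)) (η := η) (lev₀ := lev₀) (levB := levB) φ hpos hQ lev₁ (nabla115 η U)‖ ≤ CH' ∧
      ‖frakGLatticeCLM (L := (L : ℝ)) (η := η) (lev₀ := lev₀) φ hpos hQ lev₁ (nabla115 η U)‖ ≤ CG' := by
  obtain ⟨S, hS, -, hSn⟩ := exists_QprimeTowerW_rightInverse L m n (𝔸 := 𝔸) (W := W) (c₀ := c₀)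
  have hCS : (0 : ℝ) ≤ ((L : ℝ) ^ d) ^ (n + 1) * Real.sqrt (c₀ * Fintype.card (TSite d m)) := by positivity
  obtain ⟨CH', CG', ε₅, hCH', hCG', hε₅, H⟩ := exists_H1k_frakGk_CLM_bound_of_small_field L m n hL φ (c₀ := c₀) (c₁ := c₁) (η := η) α hα1
    lev₀ levB lev₁ ha hMφ hMφ' hφ hφ' τ hτ hCτ hCS
  exact ⟨CH', CG', ε₅, hCH', hCG', hε₅, fun U hU1 hreg ε ρ' δQ hε hρ' hδQ ht hUb hUε hRS hQ' hQd hpos hQs =>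
    H U hU1 hreg S S hε hρ' hδQ ht hUb hUε hRS (hS φ _) (hS φ U) hSn hSn hQ' hQd hpos hQs⟩

end SectionsFree

end Literature.MathematicalPhysics.QuantumFieldTheory.Balaban1983to89.B9Eq3126H1BoundTower

end
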